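import Literature.Barriers.NavierStokesRegularity.ComplexNavierStokesBlowupSeriesSingularTime
import Mathlib.Analysis.SpecialFunctions.Pow.Real
import Mathlib.Analysis.SpecialFunctions.Pow.Asymptotics
import Mathlib.Analysis.SpecificLimits.Basic
import HarnessLib

/-!
# Li–Sinai complex Navier–Stokes blow-up: coherent Gaussian modes give infinite energy

Tenth file of the barrier entry `ComplexNavierStokesBlowup` (D-0021), companion of
`ComplexNavierStokesBlowupSeries.lean` (the power series (3)/(46) of D. Li, Ya. G. Sinai, *Blow
ups of complex solutions of the 3D Navier–Stokes system and renormalization group method*,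
J. Eur. Math. Soc. 10 (2008) 267–313, PROVED there to solve the integral equation (1) at all
times; `mode v₀ p t` is its `p`-th term at time `t`, amplitude absorbed into the datum),
`ComplexNavierStokesBlowupSeriesEnergy.lean` (the named fact `LiSinaiSeriesEnergyInfinite`) and
`ComplexNavierStokesBlowupSeriesSingularTime.lean`
(`LiSinaiSeriesEnergyBlowup.of_infinite_of_modeDecay`).
Everything in this file is PROVED; no new fact is stated. (Fourier space is
`EuclideanSpace ℝ (Fin 3)`; `k 0, k 1, k 2` are the coordinates `k₁, k₂, k₃`.)

## What the source says, and what is made rigorous here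

Theorem 1 of the source (p. 311) describes the coefficients `g_p(k, s)` of the series after the
`√p`-rescaling `k = p κ⁽⁰⁾ + √(p k⁽⁰⁾) Y`, `κ⁽⁰⁾ = (0, 0, k⁽⁰⁾)`:
`g̃_p(Y, s) = p Z(s) Λ(s)^p exp{-|Y|²/2} (H₁⁽⁰⁾ + δ₁⁽ᵖ⁾, H₂⁽⁰⁾ + δ₂⁽ᵖ⁾, δ₃⁽ᵖ⁾)(Y, s)` with the
Hermite fixed point `H⁽⁰⁾(Y) = -2 (Y₁, Y₂)` (§7 p. 295) and `sup |δ⁽ᵖ⁾| → 0`; §10 p. 312 then takes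
`A_cr = Λ(t)⁻¹` and asserts: "`A^p g_p(k, t)` is concentrated in the domain with center at
`κ⁽⁰⁾p/√t` having the size `O(√p)` and there it takes values `O(p)`. This immediately implies that
at `t` the energy is infinite." The implication is not immediate: the supports of the terms of
different order overlap (the `p`-th term lives at heights `k₃ ≈ p k⁽⁰⁾ ± O(√p)`, so at a given
wave vector about `√p` consecutive terms are of comparable size), and the energy is the square
integral of their SUM, not the sum of their square integrals. What makes the sum large is the
COHERENCE of the profile: the main terms `-e^{-|Y|²/2} Y₁` of the first components all have the
sign of `-k₁`, whatever `p`. This file proves exactly this inference, for the terms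
`mode v₀ p t` of the series (46) (which is what the energy sees) and at the natural generality:

* `LiSinai.energy_eq_top_of_coherentGaussianModes` (**coherent Gaussian modes ⇒ infinite
  energy**). Let the datum `v₀` vanish off `{a ≤ k₃, |k| ≤ R}`, `a > 0`. Suppose that for some
  `k₀, w, w₃, Z > 0`, a real exponent `α < 3/2`, a sequence `δ_p → 0` and all `p ≥ p₁`, `k ∈ ℝ³`,
  the FIRST COMPONENT of the `p`-th term at time `t` satisfies
  `|mode v₀ p t k 0 + Z p^{-α} e^{-Q/2} k₁/(w√p)| ≤ Z p^{-α} δ_p e^{-Q/4}`,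
  `Q = (k₁² + k₂²)/(w² p) + (k₃ - p k₀)²/(w₃² p)`
  (Gaussian–Hermite main term `∝ -Y₁ e^{-|Y|²/2}` in `Y = (k₁/(w√p), k₂/(w√p), (k₃ - p k₀)/(w₃√p))`,
  error small in the Gaussian-WEIGHTED sup norm, any polynomial prefactor `p^{-α}`). Then
  `∫ ‖seriesSolution v₀ t k‖² dk = ∞`. Proof: on the box
  `k₁ ∈ [w√P, 2w√P]`, `k₂ ∈ [0, w√P]`, `k₃ ∈ [P k₀, 2P k₀]` the series is the finite sum of the
  terms `p ∈ [P k₀/R', 2P k₀/a')` (supports, `LiSinai.mode_support`); the `≥ w₃√P/k₀` terms with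
  `|k₃ - p k₀| ≤ w₃ √P` have `|Y| = O(1)` and main first component `≤ -c Z P^{-α}`, all the other
  main terms have the same sign, while the errors sum to `o(Z P^{1/2-α})` because
  `Σ_p e^{-(k₃ - p k₀)²/(4 w₃² p)} = O(√P)` (Gaussian sums over integer windows,
  `LiSinai.sum_exp_neg_sq_integerWindow_le`); so `|v₁(k, t)| ≥ c Z P^{1/2-α}` on a box of volume
  `w² k₀ P²`, and `∫ |v|² ≥ c' P^{3-2α} → ∞`.
* `LiSinai.energy_eq_top_of_coherentOneSidedModes` (the general form actually proved) and
  `LiSinai.energy_eq_top_of_quasiCoherentGaussianModes`: only an UPPER bound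
  `mode v₀ p t k 0 ≤ -Z p^{-α} e^{-Q/2} k₁/(w√p) + (error)` on `{k₁ ≥ 0}` is used (a larger coherent
  main term only helps), and the error may have, besides the Gaussian-weighted part
  `Z p^{-α} δ_p e^{-Q/4}`, an UNWEIGHTED part `Z p^{-α} η_p` with `√p η_p → 0` (summed over the
  `≍ P` generations present at a wave vector of height `≍ P k₀` this stays below the coherent
  main term `≍ Z P^{1/2-α}`); this is the form that a heat-kernel localisation in time of
  Theorem 1 (a₁) can deliver (Remark 1).
* `LiSinai.energy_eq_top_of_gaussianHermiteModes`: the same with the hypothesis in the vector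
  form of Theorem 1 (a₁), main term `-Z p^{-α} e^{-Q/2} (k₁, k₂, 0)/(w√p)`, i.e. the profile
  `H⁽⁰⁾ ∝ -(Y₁, Y₂, 0)`.
* Consequences for the catalogue (one line each from the files cited above):
  `LiSinaiSeriesEnergyInfinite.of_coherentGaussianModes` (hence the Theorem-1-backed literal form
  `LiSinaiCriticalEnergyBlowupNarrow`), and, adding the geometric decay of the terms at every
  earlier time that §10 asserts for `t' < t` ("for `p ≫ O(1/Δt)` the product `A_cr Λ(t')^p` tends
  exponentially to zero"), `LiSinaiSeriesEnergyBlowup.of_coherentGaussianModes_of_modeDecay` and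
  `complexNavierStokesBlowup_of_coherentGaussianModes_of_modeDecay`.

## Relation to `ComplexNavierStokesBlowupSeriesProfile.lean`

That companion file (landed the same day) formalises the same paragraph of §10 at the level of
the COEFFICIENTS `g_p(k, s)` (`LiSinai.coeff`, `LiSinai.mode_eq_integral_coeff`) under an exact
SIGN hypothesis on the `e`-components of all `g_p` near `t` on the union of the windows, plus a
size hypothesis on the cores (`LiSinai.energy_eq_top_of_coeffProfile`,
`ComplexNavierStokesBlowup.of_liSinaiWindows`). The present file works at the level of the
TERMS of (46) and replaces the exact sign by the Gaussian–Hermite profile with ERRORS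
(Gaussian-weighted `o(1)` and unweighted `o(p^{-1/2})`, `energy_eq_top_of_coherentOneSidedModes`):
with (a₁) as printed (`δ⁽ᵖ⁾` uniformly small INSIDE the Gaussian factor) the sign of the first
component is that of `-2Y₁ + δ₁⁽ᵖ⁾`, determined wherever `2|Y₁| > sup |δ₁⁽ᵖ⁾|`, in particular on
that file's windows; the hypotheses here are weaker in the Gaussian tails (error measured against
`e^{-|Y|²/4}` only) and need no window bookkeeping, the price being the coherent-superposition
estimate over the `≍ √P` overlapping generations. The two mechanisms are complementary and
neither file proves any hypothesis of the other.

## Remarks (ours)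

1. The terms of (46) are the heat-time integrals `∫₀ᵗ e^{-(t-s)|k|²} A^p g_p(k, s) ds` of the
   coefficients of Theorem 1, with `|k|² ≈ p² (k⁽⁰⁾)²`; under (a₁) on a left neighbourhood of `t`
   they are `≈ A^p g_p(k, t)/|k|²`, i.e. of the hypothesised form with `α = 1`; the literal "values
   `O(p)`" of §10 is `α = -1`. Both are `< 3/2`, and `3/2` is where the mechanism stops
   (`|v| ~ P^{1/2-α}` on a region of volume `~ P²` at height `P`). The passage from (a₁), a
   statement about `g_p(·, s)`, to the hypothesis on the terms is a Laplace-type estimate in `s`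
   that needs
   (a₁) uniformly for `s` near `t`; it is NOT carried out here, and no asymptotics of the terms is
   proved here: Theorem 1 (a renormalisation-group construction with computer-numerical steps,
   §7 p. 295 and p. 302) is untouched.
2. The Gaussian WEIGHT on the error is essential and is what (a₁) prints (the factor
   `exp{-|Y|²/2}` multiplies `δ⁽ᵖ⁾`). An error `o(Z p^{-α})` in the plain sup norm on the support of
   the `p`-th term (a ball of radius `∝ p`) would not give the conclusion: at a given wave vector
   `∝ P` terms overlap while only `∝ √P` of them are coherently large.
3. Only the first components and only `k₁ > 0` are used; the centre spacing `k₀`, the widths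
   `w, w₃` and the time `t` are free parameters (no sign condition on `t` is needed for the
   divergence itself).

## References

* D. Li, Ya. G. Sinai, J. Eur. Math. Soc. 10 (2008) 267–313: §2 p. 269–270 (eqs. (3)–(6),
  supports), §7 p. 295 (`H⁽⁰⁾ = -2(Y₁, Y₂)`), Thm. 1 p. 311 ((a₁), (a₂)), §10 p. 312 (eq. (46) and
  the first paragraph). [`LiSinai2008`]
-/

noncomputable section

open MeasureTheory Set Filter Topology Finset
open scoped ENNReal InnerProductSpace RealInnerProductSpace BigOperators

namespace Literature.Barriers.NavierStokesRegularity

namespace LiSinai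

/-! ### Gaussian sums over integer windows -/

/-- **Two-sided exponential sums over naturals**: for `c > 0`, `n₀ ∈ ℕ` and any finite set of
naturals, `Σ_{p ∈ J} e^{-|p - n₀|/c} ≤ 2/(1 - e^{-1/c})` (split at `n₀`; each side is a geometric
series). [folklore] -/
theorem sum_exp_neg_abs_sub_nat_le {c : ℝ} (hc : 0 < c) (n₀ : ℕ) (J : Finset ℕ) :
    ∑ p ∈ J, Real.exp (-|(p : ℝ) - n₀| / c) ≤ 2 / (1 - Real.exp (-1 / c)) := by
  set ρ : ℝ := Real.exp (-1 / c) with hρ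
  have hρ0 : 0 ≤ ρ := (Real.exp_pos _).le
  have hρ1 : ρ < 1 := Real.exp_lt_one_iff.2 (by rw [neg_div]; exact neg_neg_of_pos (by positivity))
  have hsumm : Summable fun q : ℕ => ρ ^ q := summable_geometric_of_lt_one hρ0 hρ1
  have htsum : ∑' q : ℕ, ρ ^ q = (1 - ρ)⁻¹ := tsum_geometric_of_lt_one hρ0 hρ1
  -- each term is `ρ^{|p - n₀|}` with a natural exponent
  have hterm : ∀ p : ℕ, Real.exp (-|(p : ℝ) - n₀| / c) =
      ρ ^ (if n₀ ≤ p then p - n₀ else n₀ - p) := by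
    intro p
    have key : ∀ m : ℕ, Real.exp (-(m : ℝ) / c) = ρ ^ m := by
      intro m
      rw [hρ, ← Real.exp_nat_mul]
      congr 1
      ring
    split_ifs with h
    · rw [← key, Nat.cast_sub h, abs_of_nonneg (by simpa using h)]
    · push Not at h
      rw [← key, Nat.cast_sub h.le, abs_of_neg (by simpa using h), neg_sub]
  simp_rw [hterm]
  rw [← Finset.sum_filter_add_sum_filter_not J (fun p => n₀ ≤ p)]
  have h1 : ∑ p ∈ J.filter (fun p => n₀ ≤ p), ρ ^ (if n₀ ≤ p then p - n₀ else n₀ - p) ≤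
      (1 - ρ)⁻¹ := by
    have hinj : Set.InjOn (fun p : ℕ => p - n₀) (J.filter (fun p => n₀ ≤ p) : Set ℕ) := by
      intro p hp q hq hpq
      simp only [Finset.coe_filter, Set.mem_setOf_eq] at hp hq
      simp only at hpq
      omega
    calc ∑ p ∈ J.filter (fun p => n₀ ≤ p), ρ ^ (if n₀ ≤ p then p - n₀ else n₀ - p)
        = ∑ p ∈ J.filter (fun p => n₀ ≤ p), ρ ^ (p - n₀) :=
          Finset.sum_congr rfl fun p hp => by rw [if_pos (Finset.mem_filter.1 hp).2]
      _ = ∑ q ∈ (J.filter (fun p => n₀ ≤ p)).image (fun p => p - n₀), ρ ^ q :=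
          (Finset.sum_image hinj).symm
      _ ≤ ∑' q : ℕ, ρ ^ q := hsumm.sum_le_tsum _ (fun q _ => pow_nonneg hρ0 q)
      _ = (1 - ρ)⁻¹ := htsum
  have h2 : ∑ p ∈ J.filter (fun p => ¬ n₀ ≤ p), ρ ^ (if n₀ ≤ p then p - n₀ else n₀ - p) ≤
      (1 - ρ)⁻¹ := by
    have hinj : Set.InjOn (fun p : ℕ => n₀ - p) (J.filter (fun p => ¬ n₀ ≤ p) : Set ℕ) := by
      intro p hp q hq hpq
      simp only [Finset.coe_filter, Set.mem_setOf_eq] at hp hq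
      simp only at hpq
      omega
    calc ∑ p ∈ J.filter (fun p => ¬ n₀ ≤ p), ρ ^ (if n₀ ≤ p then p - n₀ else n₀ - p)
        = ∑ p ∈ J.filter (fun p => ¬ n₀ ≤ p), ρ ^ (n₀ - p) :=
          Finset.sum_congr rfl fun p hp => by rw [if_neg (Finset.mem_filter.1 hp).2]
      _ = ∑ q ∈ (J.filter (fun p => ¬ n₀ ≤ p)).image (fun p => n₀ - p), ρ ^ q :=
          (Finset.sum_image hinj).symm
      _ ≤ ∑' q : ℕ, ρ ^ q := hsumm.sum_le_tsum _ (fun q _ => pow_nonneg hρ0 q)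
      _ = (1 - ρ)⁻¹ := htsum
  calc _ ≤ (1 - ρ)⁻¹ + (1 - ρ)⁻¹ := add_le_add h1 h2
    _ = 2 / (1 - ρ) := by ring

/-- A Gaussian lies below an exponential: `e^{-u²/s} ≤ e^{1/4} e^{-|u|/√s}` (`s > 0`), i.e.
`|u|/√s ≤ u²/s + 1/4`. [folklore] -/
theorem exp_neg_sq_div_le {s : ℝ} (hs : 0 < s) (u : ℝ) :
    Real.exp (-u ^ 2 / s) ≤ Real.exp (1 / 4) * Real.exp (-|u| / Real.sqrt s) := by
  rw [← Real.exp_add]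
  refine Real.exp_le_exp.2 ?_
  have hsq : Real.sqrt s ^ 2 = s := Real.sq_sqrt hs.le
  have hspos : 0 < Real.sqrt s := Real.sqrt_pos.2 hs
  have key : 0 ≤ (|u| / Real.sqrt s - 1 / 2) ^ 2 := sq_nonneg _
  have h1 : (|u| / Real.sqrt s) ^ 2 = u ^ 2 / s := by
    rw [div_pow, sq_abs, hsq]
  have h2 : -(|u| / Real.sqrt s) ^ 2 ≤ 1 / 4 + -|u| / Real.sqrt s := by
    rw [neg_div]; nlinarith [key]
  rw [h1] at h2
  rw [neg_div]
  linarith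

/-- **Gaussian sums over integer windows**: for `s ≥ 1`, any real centre `x` and any finite set
of naturals `J`, `Σ_{p ∈ J} e^{-(p - x)²/s} ≤ 4 e^{5/4} √s` (elementary: Gaussian ≤ exponential,
then geometric series around `⌊x⌋₊`; a sharper constant by comparison with the Gaussian integral
is `Literature.NumberTheory.LFunctions.sum_exp_neg_sq_le`, not imported here). [folklore] -/
theorem sum_exp_neg_sq_integerWindow_le {s : ℝ} (hs : 1 ≤ s) (x : ℝ) (J : Finset ℕ) :
    ∑ p ∈ J, Real.exp (-((p : ℝ) - x) ^ 2 / s) ≤ 4 * Real.exp (5 / 4) * Real.sqrt s := by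
  have hs0 : 0 < s := by linarith
  set c : ℝ := Real.sqrt s with hc
  have hc1 : 1 ≤ c := by rw [hc]; exact Real.one_le_sqrt.2 hs
  have hc0 : 0 < c := by linarith
  set n₀ : ℕ := ⌊x⌋₊ with hn₀
  -- `|p - x| ≥ |p - n₀| - 1`
  have hdist : ∀ p : ℕ, |(p : ℝ) - n₀| - 1 ≤ |(p : ℝ) - x| := by
    intro p
    rcases le_or_gt 0 x with hx | hx
    · have h1 : (n₀ : ℝ) ≤ x := Nat.floor_le hx
      have h2 : x < n₀ + 1 := Nat.lt_floor_add_one x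
      have : |(p : ℝ) - n₀| ≤ |(p : ℝ) - x| + |x - n₀| := by
        simpa using abs_sub_le (p : ℝ) x n₀
      have h3 : |x - (n₀ : ℝ)| ≤ 1 := by rw [abs_le]; constructor <;> linarith
      linarith
    · have h0 : n₀ = 0 := by rw [hn₀]; exact Nat.floor_of_nonpos hx.le
      rw [h0, Nat.cast_zero, sub_zero, abs_of_nonneg (Nat.cast_nonneg p),
        abs_of_nonneg (by linarith [Nat.cast_nonneg (α := ℝ) p])]
      linarith
  have hstep : ∀ p : ℕ, Real.exp (-((p : ℝ) - x) ^ 2 / s) ≤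
      Real.exp (1 / 4 + 1 / c) * Real.exp (-|(p : ℝ) - n₀| / c) := by
    intro p
    calc Real.exp (-((p : ℝ) - x) ^ 2 / s)
        ≤ Real.exp (1 / 4) * Real.exp (-|(p : ℝ) - x| / c) := exp_neg_sq_div_le hs0 _
      _ ≤ Real.exp (1 / 4) * Real.exp ((1 - |(p : ℝ) - n₀|) / c) := by
          gcongr
          linarith [hdist p]
      _ = Real.exp (1 / 4 + 1 / c) * Real.exp (-|(p : ℝ) - n₀| / c) := by
          rw [← Real.exp_add, ← Real.exp_add]
          congr 1
          ring
  calc ∑ p ∈ J, Real.exp (-((p : ℝ) - x) ^ 2 / s)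
      ≤ ∑ p ∈ J, Real.exp (1 / 4 + 1 / c) * Real.exp (-|(p : ℝ) - n₀| / c) :=
        Finset.sum_le_sum fun p _ => hstep p
    _ = Real.exp (1 / 4 + 1 / c) * ∑ p ∈ J, Real.exp (-|(p : ℝ) - n₀| / c) := by
        rw [Finset.mul_sum]
    _ ≤ Real.exp (1 / 4 + 1 / c) * (2 / (1 - Real.exp (-1 / c))) :=
        mul_le_mul_of_nonneg_left (sum_exp_neg_abs_sub_nat_le hc0 n₀ J) (Real.exp_pos _).le
    _ ≤ Real.exp (5 / 4) * (2 * (1 + c)) := by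
        refine mul_le_mul (Real.exp_le_exp.2 ?_) ?_ ?_ (Real.exp_pos _).le
        · have : 1 / c ≤ 1 := by rw [div_le_one hc0]; exact hc1
          linarith
        · -- `1/(1 - e^{-y}) ≤ 1 + 1/y` for `y = 1/c > 0` (from `1 + y ≤ e^y`; cf.
          -- `Literature.NumberTheory.LFunctions.HuxleyZeroDetection.inv_one_sub_exp_neg_le`)
          have h : 1 / (1 - Real.exp (-1 / c)) ≤ 1 + c := by
            set y : ℝ := 1 / c with hy_def
            have hy : 0 < y := by positivity
            have h1 : Real.exp (-y) ≤ 1 / (1 + y) := by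
              rw [Real.exp_neg, one_div]
              exact inv_anti₀ (by positivity) (by linarith [Real.add_one_le_exp y])
            have hy1 : (1 + y) ≠ 0 := by positivity
            have h2 : y / (1 + y) ≤ 1 - Real.exp (-y) := by
              have : y / (1 + y) = 1 - 1 / (1 + y) := by field_simp; ring
              linarith
            have h3 : 0 < y / (1 + y) := by positivity
            calc 1 / (1 - Real.exp (-1 / c)) = 1 / (1 - Real.exp (-y)) := by rw [hy_def, neg_div]
              _ ≤ 1 / (y / (1 + y)) := one_div_le_one_div_of_le h3 h2
              _ = 1 + 1 / y := by field_simp; ring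
              _ = 1 + c := by rw [hy_def, one_div_one_div]
          have : 2 / (1 - Real.exp (-1 / c)) = 2 * (1 / (1 - Real.exp (-1 / c))) := by ring
          rw [this]
          linarith
        · have hlt : Real.exp (-1 / c) < 1 :=
            Real.exp_lt_one_iff.2 (by rw [neg_div]; exact neg_neg_of_pos (by positivity))
          exact div_nonneg zero_le_two (by linarith)
    _ ≤ 4 * Real.exp (5 / 4) * c := by nlinarith [Real.exp_pos (5 / 4 : ℝ)]


/-! ### Coordinate boxes in `ℝ³` and real powers on logarithmic windows -/

/-- Volume of a coordinate box in `ℝ³` (Lebesgue measure on `EuclideanSpace ℝ (Fin 3)` is the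
product measure under the coordinate map, `PiLp.volume_preserving_ofLp`). [folklore] -/
theorem volume_coordBox {lo hi : Fin 3 → ℝ} (h : lo ≤ hi) :
    volume (WithLp.ofLp ⁻¹' Icc lo hi : Set (EuclideanSpace ℝ (Fin 3))) =
      ENNReal.ofReal ((hi 0 - lo 0) * (hi 1 - lo 1) * (hi 2 - lo 2)) := by
  rw [(PiLp.volume_preserving_ofLp (Fin 3)).measure_preimage
      measurableSet_Icc.nullMeasurableSet, Real.volume_Icc_pi, Fin.prod_univ_three,
    ← ENNReal.ofReal_mul (sub_nonneg.2 (h 0)), ← ENNReal.ofReal_mul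
      (mul_nonneg (sub_nonneg.2 (h 0)) (sub_nonneg.2 (h 1)))]

/-- Measurability of a coordinate box in `ℝ³`. [folklore] -/
theorem measurableSet_coordBox (lo hi : Fin 3 → ℝ) :
    MeasurableSet (WithLp.ofLp ⁻¹' Icc lo hi : Set (EuclideanSpace ℝ (Fin 3))) :=
  measurableSet_Icc.preimage (PiLp.volume_preserving_ofLp (Fin 3)).measurable

/-- Two-sided comparison of real powers on a logarithmic window: if `|log (x/P)| ≤ L` then
`e^{-|α|L} P^{-α} ≤ x^{-α} ≤ e^{|α|L} P^{-α}`. [folklore] -/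
theorem rpow_neg_window {x P L α : ℝ} (hx : 0 < x) (hP : 0 < P)
    (hL : |Real.log (x / P)| ≤ L) :
    Real.exp (-(|α| * L)) * P ^ (-α) ≤ x ^ (-α) ∧ x ^ (-α) ≤ Real.exp (|α| * L) * P ^ (-α) := by
  have hlog : Real.log x = Real.log P + Real.log (x / P) := by
    rw [Real.log_div hx.ne' hP.ne']; ring
  have hx' : x ^ (-α) = P ^ (-α) * Real.exp (-α * Real.log (x / P)) := by
    rw [Real.rpow_def_of_pos hx, Real.rpow_def_of_pos hP, hlog, ← Real.exp_add]
    congr 1; ring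
  have hb : |-α * Real.log (x / P)| ≤ |α| * L := by
    rw [abs_mul, abs_neg]
    exact mul_le_mul_of_nonneg_left hL (abs_nonneg _)
  have hPpos : 0 < P ^ (-α) := Real.rpow_pos_of_pos hP _
  rw [hx']
  constructor
  · rw [mul_comm]
    exact mul_le_mul_of_nonneg_left (Real.exp_le_exp.2 (neg_le_of_abs_le hb)) hPpos.le
  · rw [mul_comm (Real.exp _)]
    exact mul_le_mul_of_nonneg_left (Real.exp_le_exp.2 (le_of_abs_le hb)) hPpos.le

/-- `|log y| ≤ log M` when `1/M ≤ y ≤ M` and `M ≥ 1`. [folklore] -/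
theorem abs_log_le_log {y M : ℝ} (hM : 1 ≤ M) (h1 : 1 / M ≤ y) (h2 : y ≤ M) :
    |Real.log y| ≤ Real.log M := by
  have hM0 : 0 < M := by linarith
  have hy : 0 < y := lt_of_lt_of_le (by positivity) h1
  rw [abs_le]
  constructor
  · rw [← Real.log_inv]
    have : M⁻¹ ≤ y := by rwa [one_div] at h1
    exact Real.log_le_log (by positivity) this
  · exact Real.log_le_log hy h2


/-! ### Coherent Gaussian modes give infinite energy -/

/-- **A coherent one-sided Gaussian–Hermite bound on the terms at one time forces infinite energy
at that time** — the most general form proved here of the inference of §10 p. 312 for the terms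
of the series (46). Let the datum `v₀` vanish off `{a ≤ k₃, |k| ≤ R}` with `a > 0` (the printed
data (39), §7 p. 295, do), let `k₀, w, w₃, Z > 0`, `α < 3/2`, `δ_p → 0`, `√p · η_p → 0`, and
suppose that for all `p ≥ p₁` and all `k` with `k₁ ≥ 0` the first component of the `p`-th term of
the series at time `t` lies BELOW the negative Gaussian–Hermite profile of Theorem 1 (a₁) (p. 311;
`H₁⁽⁰⁾(Y) = -2Y₁`, §7 p. 295) up to an error with a Gaussian-weighted and an unweighted part:
`mode v₀ p t k 0 ≤ -Z p^{-α} e^{-Q/2} k₁/(w√p) + Z p^{-α} (δ_p e^{-Q/4} + η_p)`,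
`Q = (k₁² + k₂²)/(w² p) + (k₃ - p k₀)²/(w₃² p)`.
Then `∫ ‖seriesSolution v₀ t k‖² dk = ∞`. Only this one-sided bound on the half-space `{k₁ ≥ 0}`
enters the coherence argument (a larger coherent main term only helps); the unweighted errors of
the `≍ P` generations present at a wave vector of height `≍ P k₀` sum below the coherent main
term `≍ Z P^{1/2-α}` exactly when `η_p = o(p^{-1/2})`. See the module docstring for the estimate
and for what this does NOT prove. [cite: LiSinai2008, Thm. 1 p. 311 and §10 p. 312] -/
theorem energy_eq_top_of_coherentOneSidedModes
    {v₀ : EuclideanSpace ℝ (Fin 3) → EuclideanSpace ℝ (Fin 3)} {a R : ℝ} (ha : 0 < a)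
    (hv₀ : ∀ k, v₀ k ≠ 0 → a ≤ k 2 ∧ ‖k‖ ≤ R)
    {t k₀ w w₃ Z α : ℝ} (hk₀ : 0 < k₀) (hw : 0 < w) (hw₃ : 0 < w₃) (hZ : 0 < Z) (hα : α < 3 / 2)
    {p₁ : ℕ} {δ η : ℕ → ℝ} (hδ : Tendsto δ atTop (𝓝 0))
    (hη : Tendsto (fun p : ℕ => Real.sqrt p * η p) atTop (𝓝 0))
    (hmode : ∀ p : ℕ, p₁ ≤ p → ∀ k : EuclideanSpace ℝ (Fin 3), 0 ≤ k 0 →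
      mode v₀ p t k 0 ≤ -(Z * (p : ℝ) ^ (-α) *
          Real.exp (-((k 0 ^ 2 + k 1 ^ 2) / (w ^ 2 * p) + (k 2 - p * k₀) ^ 2 / (w₃ ^ 2 * p)) / 2) *
          (k 0 / (w * Real.sqrt p))) +
        Z * (p : ℝ) ^ (-α) * (δ p *
          Real.exp (-((k 0 ^ 2 + k 1 ^ 2) / (w ^ 2 * p) + (k 2 - p * k₀) ^ 2 / (w₃ ^ 2 * p)) / 4) +
          η p)) :
    ∫⁻ k, ‖seriesSolution v₀ t k‖ₑ ^ 2 = ∞ := by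
  /- support parameters normalised so that `a' ≤ k₀/2` and `2 k₀ ≤ R'` -/
  obtain ⟨a', ha'_def⟩ : ∃ a' : ℝ, a' = min a (k₀ / 2) := ⟨_, rfl⟩
  obtain ⟨R', hR'_def⟩ : ∃ R' : ℝ, R' = max R (2 * k₀) := ⟨_, rfl⟩
  have ha'0 : 0 < a' := by rw [ha'_def]; exact lt_min ha (by positivity)
  have ha'k : a' ≤ k₀ / 2 := by rw [ha'_def]; exact min_le_right _ _
  have hR'k : 2 * k₀ ≤ R' := by rw [hR'_def]; exact le_max_right _ _
  have hR'0 : 0 < R' := by linarith only [hR'k, hk₀]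
  have hv₀' : ∀ k, v₀ k ≠ 0 → a' ≤ k 2 ∧ ‖k‖ ≤ R' := fun k hk =>
    ⟨(by rw [ha'_def]; exact min_le_left _ _ : a' ≤ a).trans (hv₀ k hk).1,
      (hv₀ k hk).2.trans (by rw [hR'_def]; exact le_max_left _ _)⟩
  /- constants -/
  obtain ⟨M₀, hM₀_def⟩ : ∃ M₀ : ℝ, M₀ = max (R' / k₀) (2 * k₀ / a') := ⟨_, rfl⟩
  have hM₀R : R' / k₀ ≤ M₀ := by rw [hM₀_def]; exact le_max_left _ _
  have hM₀a : 2 * k₀ / a' ≤ M₀ := by rw [hM₀_def]; exact le_max_right _ _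
  have hM₀1 : 1 ≤ M₀ := by
    refine le_trans ?_ hM₀R
    rw [le_div_iff₀ hk₀]; linarith only [hR'k, hk₀]
  obtain ⟨L₀, hL₀_def⟩ : ∃ L₀ : ℝ, L₀ = Real.log M₀ := ⟨_, rfl⟩
  obtain ⟨C₁, hC₁_def⟩ : ∃ C₁ : ℝ,
      C₁ = w₃ * Real.exp (-(|α| * Real.log 3)) * Real.exp (-6) / (2 * k₀) := ⟨_, rfl⟩
  have hC₁ : 0 < C₁ := by rw [hC₁_def]; positivity
  obtain ⟨C₂, hC₂_def⟩ : ∃ C₂ : ℝ, C₂ = Real.exp (|α| * L₀) * (4 * Real.exp (5 / 4)) *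
      (2 * w₃ / k₀) * Real.sqrt (2 * k₀ / a' + 1) := ⟨_, rfl⟩
  have hC₂ : 0 < C₂ := by rw [hC₂_def]; positivity
  obtain ⟨ε, hε_def⟩ : ∃ ε : ℝ, ε = C₁ / (4 * C₂) := ⟨_, rfl⟩
  have hε : 0 < ε := by rw [hε_def]; positivity
  obtain ⟨c₀, hc₀_def⟩ : ∃ c₀ : ℝ, c₀ = Real.sqrt (k₀ / R') := ⟨_, rfl⟩
  have hc₀ : 0 < c₀ := by rw [hc₀_def]; exact Real.sqrt_pos.2 (by positivity)
  obtain ⟨C₃, hC₃_def⟩ : ∃ C₃ : ℝ, C₃ = Real.exp (|α| * L₀) * (2 * k₀ / a' + 1) / c₀ := ⟨_, rfl⟩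
  have hC₃ : 0 < C₃ := by rw [hC₃_def]; positivity
  obtain ⟨ε₂, hε₂_def⟩ : ∃ ε₂ : ℝ, ε₂ = C₁ / (4 * C₃) := ⟨_, rfl⟩
  have hε₂ : 0 < ε₂ := by rw [hε₂_def]; positivity
  obtain ⟨K, hK_def⟩ : ∃ K : ℝ, K = (Z * C₁ / 2) ^ 2 * w ^ 2 * k₀ := ⟨_, rfl⟩
  have hK : 0 < K := by rw [hK_def]; positivity
  /- `δ` is eventually `≤ ε` -/
  obtain ⟨p₂, hp₂⟩ : ∃ p₂ : ℕ, ∀ p, p₂ ≤ p → |δ p| ≤ ε := by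
    obtain ⟨N, hN⟩ := (Metric.tendsto_atTop.1 hδ) ε hε
    exact ⟨N, fun p hp => by simpa [Real.dist_eq] using (hN p hp).le⟩
  obtain ⟨p₃, hp₃⟩ : ∃ p₃ : ℕ, ∀ p, p₃ ≤ p → |Real.sqrt p * η p| ≤ ε₂ := by
    obtain ⟨N, hN⟩ := (Metric.tendsto_atTop.1 hη) ε₂ hε₂
    exact ⟨N, fun p hp => by simpa [Real.dist_eq] using (hN p hp).le⟩
  /- choice of the generation scale `P` -/
  refine ENNReal.eq_top_of_forall_nnreal_le fun r => ?_
  obtain ⟨T, hT_def⟩ : ∃ T : ℝ, T = (2 * w₃ / k₀) ^ 2 + (k₀ / w₃) ^ 2 + k₀ ^ 2 / (4 * w₃ ^ 2) +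
      1 + ((p₁ : ℝ) + p₂ + p₃) * R' / k₀ := ⟨_, rfl⟩
  have ev1 : ∀ᶠ P : ℕ in atTop, T ≤ (P : ℝ) :=
    tendsto_natCast_atTop_atTop.eventually_ge_atTop T
  have ev2 : ∀ᶠ P : ℕ in atTop, (r : ℝ) ≤ K * (P : ℝ) ^ (3 - 2 * α) := by
    have ht : Tendsto (fun P : ℕ => K * (P : ℝ) ^ (3 - 2 * α)) atTop atTop :=
      Tendsto.const_mul_atTop hK
        ((tendsto_rpow_atTop (by linarith only [hα])).comp tendsto_natCast_atTop_atTop)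
    exact ht.eventually_ge_atTop _
  obtain ⟨P, hPT, hP6⟩ := (ev1.and ev2).exists
  -- unpacking `T ≤ P`
  have hT1 : 0 ≤ (2 * w₃ / k₀) ^ 2 := sq_nonneg _
  have hT2 : 0 ≤ (k₀ / w₃) ^ 2 := sq_nonneg _
  have hT3 : 0 ≤ k₀ ^ 2 / (4 * w₃ ^ 2) := by positivity
  have hT4 : 0 ≤ ((p₁ : ℝ) + p₂ + p₃) * R' / k₀ := by positivity
  rw [hT_def] at hPT
  have hP1 : (1 : ℝ) ≤ P := by linarith only [hPT, hT1, hT2, hT3, hT4]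
  have hPpos : (0 : ℝ) < P := by linarith only [hP1]
  obtain ⟨sP, hsP_def⟩ : ∃ sP : ℝ, sP = Real.sqrt P := ⟨_, rfl⟩
  have hsPpos : 0 < sP := by rw [hsP_def]; exact Real.sqrt_pos.2 hPpos
  have hsPsP : sP * sP = P := by rw [hsP_def]; exact Real.mul_self_sqrt hPpos.le
  have hP2 : 2 * w₃ / k₀ ≤ sP := by
    rw [hsP_def]
    exact (Real.le_sqrt (by positivity) hPpos.le).2 (by linarith only [hPT, hT2, hT3, hT4])
  have hP3 : k₀ / w₃ ≤ sP := by
    rw [hsP_def]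
    exact (Real.le_sqrt (by positivity) hPpos.le).2 (by linarith only [hPT, hT1, hT3, hT4])
  have hP5 : k₀ ^ 2 / (4 * w₃ ^ 2) ≤ P := by linarith only [hPT, hT1, hT2, hT4]
  have hP4 : ((p₁ : ℝ) + p₂ + p₃) * R' / k₀ ≤ P := by linarith only [hPT, hT1, hT2, hT3]
  have hw₃sP : w₃ * sP ≤ P * k₀ / 2 := by
    have h1 : 2 * w₃ ≤ sP * k₀ := by rwa [div_le_iff₀ hk₀] at hP2
    have h2 : 2 * w₃ * sP ≤ sP * k₀ * sP := mul_le_mul_of_nonneg_right h1 hsPpos.le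
    have h3 : sP * k₀ * sP = P * k₀ := by rw [← hsPsP]; ring
    linarith only [h2, h3]
  have hsPk : 1 ≤ w₃ * sP / k₀ := by
    rw [le_div_iff₀ hk₀, one_mul]
    have := (div_le_iff₀ hw₃).1 hP3
    linarith only [this]
  obtain ⟨Pα, hPα_def⟩ : ∃ Pα : ℝ, Pα = (P : ℝ) ^ (-α) := ⟨_, rfl⟩
  have hPα : 0 < Pα := by rw [hPα_def]; exact Real.rpow_pos_of_pos hPpos _
  /- the box `B = [w√P, 2w√P] × [0, w√P] × [P k₀, 2 P k₀]` -/
  obtain ⟨lo, hlo⟩ : ∃ lo : Fin 3 → ℝ, lo = ![w * sP, 0, P * k₀] := ⟨_, rfl⟩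
  obtain ⟨hi, hhi⟩ : ∃ hi : Fin 3 → ℝ, hi = ![2 * w * sP, w * sP, 2 * P * k₀] := ⟨_, rfl⟩
  have hwsP : 0 < w * sP := mul_pos hw hsPpos
  have hPk : 0 < (P : ℝ) * k₀ := mul_pos hPpos hk₀
  have hlohi : lo ≤ hi := by
    rw [hlo, hhi]; intro i
    fin_cases i <;> simp <;> linarith only [hwsP, hPk]
  obtain ⟨B, hB_def⟩ : ∃ B : Set (EuclideanSpace ℝ (Fin 3)), B = WithLp.ofLp ⁻¹' Icc lo hi :=
    ⟨_, rfl⟩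
  have hBmeas : MeasurableSet B := by rw [hB_def]; exact measurableSet_coordBox lo hi
  have hBvol : volume B = ENNReal.ofReal (w * sP * (w * sP) * (P * k₀)) := by
    rw [hB_def, volume_coordBox hlohi]
    congr 1
    rw [hlo, hhi]
    simp
    ring
  /- the pointwise lower bound on the box -/
  obtain ⟨m, hm_def⟩ : ∃ m : ℝ, m = Z * C₁ * sP * Pα / 2 := ⟨_, rfl⟩
  have hm0 : 0 < m := by rw [hm_def]; positivity
  have hlow : ∀ k ∈ B, m ≤ ‖seriesSolution v₀ t k‖ := by
    intro k hk
    have hk' := hk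
    rw [hB_def, Set.mem_preimage, Set.mem_Icc] at hk'
    obtain ⟨hkl, hku⟩ := hk'
    have hk0l : w * sP ≤ k 0 := by simpa [hlo] using hkl 0
    have hk0u : k 0 ≤ 2 * w * sP := by simpa [hhi] using hku 0
    have hk1l : 0 ≤ k 1 := by simpa [hlo] using hkl 1
    have hk1u : k 1 ≤ w * sP := by simpa [hhi] using hku 1
    have hk2l : (P : ℝ) * k₀ ≤ k 2 := by simpa [hlo] using hkl 2
    have hk2u : k 2 ≤ 2 * P * k₀ := by simpa [hhi] using hku 2
    have hk0pos : 0 < k 0 := lt_of_lt_of_le (by positivity) hk0l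
    -- the finite window of generations `J = [pl, N)`
    obtain ⟨N, hN_def⟩ : ∃ N : ℕ, N = ⌊2 * (P : ℝ) * k₀ / a'⌋₊ + 1 := ⟨_, rfl⟩
    obtain ⟨pl, hpl_def⟩ : ∃ pl : ℕ, pl = ⌈(P : ℝ) * k₀ / R'⌉₊ := ⟨_, rfl⟩
    have hkN : k 2 < N * a' := by
      have h := lt_floor_succ_mul ha'0 (2 * (P : ℝ) * k₀)
      rw [← hN_def] at h
      exact hk2u.trans_lt h
    have hser : seriesSolution v₀ t k = ∑ p ∈ Finset.range N, mode v₀ p t k :=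
      seriesSolution_eq_sum ha'0 hv₀' hkN t
    have hnormk : k 2 ≤ ‖k‖ := (le_abs_self _).trans (by simpa using PiLp.norm_apply_le k 2)
    have hlowmodes : ∀ p, p < pl → mode v₀ p t k = 0 := by
      intro p hp
      by_contra hne
      have h1 := (mode_support hv₀' p t k hne).2
      have h2 : (p : ℝ) < P * k₀ / R' := Nat.lt_ceil.1 (by rwa [hpl_def] at hp)
      rw [lt_div_iff₀ hR'0] at h2
      linarith only [h1, h2, hnormk, hk2l]
    have hserJ : seriesSolution v₀ t k = ∑ p ∈ Finset.Ico pl N, mode v₀ p t k := by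
      rw [hser]
      refine (Finset.sum_subset (fun p hp => ?_) (fun p hp hpn => ?_)).symm
      · exact Finset.mem_range.2 (Finset.mem_Ico.1 hp).2
      · have : p < pl := by
          by_contra h
          push Not at h
          exact hpn (Finset.mem_Ico.2 ⟨h, Finset.mem_range.1 hp⟩)
        exact hlowmodes p this
    have hcoord : seriesSolution v₀ t k 0 = ∑ p ∈ Finset.Ico pl N, mode v₀ p t k 0 := by
      rw [hserJ, WithLp.ofLp_sum, Finset.sum_apply]
    -- facts about `pl`, `N`
    have hpl_pos : 0 < pl := by rw [hpl_def]; exact Nat.ceil_pos.2 (by positivity)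
    have hp₁pl : p₁ ≤ pl ∧ p₂ ≤ pl ∧ p₃ ≤ pl := by
      have h1 : ((p₁ : ℝ) + p₂ + p₃) ≤ P * k₀ / R' := by
        rw [le_div_iff₀ hR'0]
        have := hP4
        rw [div_le_iff₀ hk₀] at this
        exact this
      have h2 : (P : ℝ) * k₀ / R' ≤ pl := by rw [hpl_def]; exact Nat.le_ceil _
      have h3 : (0 : ℝ) ≤ p₁ := Nat.cast_nonneg p₁
      have h4 : (0 : ℝ) ≤ p₂ := Nat.cast_nonneg p₂
      have h5 : (0 : ℝ) ≤ p₃ := Nat.cast_nonneg p₃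
      refine ⟨?_, ?_, ?_⟩
      · exact_mod_cast (show (p₁ : ℝ) ≤ pl by linarith only [h1, h2, h4, h5])
      · exact_mod_cast (show (p₂ : ℝ) ≤ pl by linarith only [h1, h2, h3, h5])
      · exact_mod_cast (show (p₃ : ℝ) ≤ pl by linarith only [h1, h2, h3, h4])
    have hNle : (N : ℝ) - 1 ≤ 2 * P * k₀ / a' := by
      have e : (N : ℝ) = (⌊2 * (P : ℝ) * k₀ / a'⌋₊ : ℝ) + 1 := by rw [hN_def]; push_cast; ring
      rw [e]
      linarith only [Nat.floor_le (show 0 ≤ 2 * (P : ℝ) * k₀ / a' by positivity)]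
    have hNge : (4 : ℝ) * P ≤ N := by
      have h1 : (4 : ℝ) * P ≤ 2 * P * k₀ / a' := by
        rw [le_div_iff₀ ha'0]
        have := mul_le_mul_of_nonneg_left ha'k hPpos.le
        linarith only [this]
      have h2 : 2 * (P : ℝ) * k₀ / a' < N := by
        have := Nat.lt_floor_add_one (2 * (P : ℝ) * k₀ / a')
        rw [hN_def]; push_cast; linarith only [this]
      linarith only [h1, h2]
    have hNpos : (0 : ℝ) < N := by linarith only [hNge, hPpos]
    -- Gaussian window parameter
    obtain ⟨s, hs_def⟩ : ∃ s : ℝ, s = (2 * w₃ / k₀) ^ 2 * N := ⟨_, rfl⟩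
    have hs1 : 1 ≤ s := by
      have h1 : k₀ ^ 2 ≤ 4 * w₃ ^ 2 * P := by
        rw [div_le_iff₀ (by positivity)] at hP5; linarith only [hP5]
      have h2 : s = 4 * w₃ ^ 2 * N / k₀ ^ 2 := by rw [hs_def]; ring
      rw [h2, le_div_iff₀ (by positivity)]
      have hPN : (P : ℝ) ≤ N := by linarith only [hNge, hPpos]
      have := mul_le_mul_of_nonneg_left hPN (by positivity : (0 : ℝ) ≤ 4 * w₃ ^ 2)
      linarith only [this, h1]
    have hsqrt_s : Real.sqrt s = (2 * w₃ / k₀) * Real.sqrt N := by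
      rw [hs_def, Real.sqrt_mul (sq_nonneg _), Real.sqrt_sq (by positivity)]
    have hsqrtN : Real.sqrt N ≤ Real.sqrt (2 * k₀ / a' + 1) * sP := by
      rw [hsP_def, ← Real.sqrt_mul (by positivity)]
      refine Real.sqrt_le_sqrt ?_
      have h1 : (N : ℝ) ≤ 2 * P * k₀ / a' + 1 := by linarith only [hNle]
      have h2 : 2 * (P : ℝ) * k₀ / a' + 1 ≤ (2 * k₀ / a' + 1) * P := by
        rw [add_mul]
        have : 2 * (P : ℝ) * k₀ / a' = 2 * k₀ / a' * P := by ring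
        rw [this]; linarith only [hP1]
      exact h1.trans h2
    have hsqs : Real.sqrt s ≤ (2 * w₃ / k₀) * (Real.sqrt (2 * k₀ / a' + 1) * sP) := by
      rw [hsqrt_s]; gcongr
    -- the profile at the point `k`
    obtain ⟨Q, hQ_def⟩ : ∃ Q : ℕ → ℝ, Q = fun p : ℕ =>
        (k 0 ^ 2 + k 1 ^ 2) / (w ^ 2 * p) + (k 2 - p * k₀) ^ 2 / (w₃ ^ 2 * p) := ⟨_, rfl⟩
    obtain ⟨Mn, hMn_def⟩ : ∃ Mn : ℕ → ℝ, Mn = fun p : ℕ =>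
        Z * (p : ℝ) ^ (-α) * Real.exp (-(Q p) / 2) * (k 0 / (w * Real.sqrt p)) := ⟨_, rfl⟩
    have hdecomp : ∀ p ∈ Finset.Ico pl N, mode v₀ p t k 0 + Mn p ≤
        Z * (p : ℝ) ^ (-α) * (ε * Real.exp (-(Q p) / 4) + ε₂ / Real.sqrt p) := by
      intro p hp
      have hp1 : p₁ ≤ p := hp₁pl.1.trans (Finset.mem_Ico.1 hp).1
      have hp2 : p₂ ≤ p := hp₁pl.2.1.trans (Finset.mem_Ico.1 hp).1
      have hp3 : p₃ ≤ p := hp₁pl.2.2.trans (Finset.mem_Ico.1 hp).1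
      have h := hmode p hp1 k hk0pos.le
      have hδp : δ p ≤ ε := (le_abs_self _).trans (hp₂ p hp2)
      have hppos : (0 : ℝ) < p := by exact_mod_cast hpl_pos.trans_le (Finset.mem_Ico.1 hp).1
      have hpα : 0 ≤ (p : ℝ) ^ (-α) := (Real.rpow_pos_of_pos hppos _).le
      have hsqp : 0 < Real.sqrt p := Real.sqrt_pos.2 hppos
      have hηp : η p ≤ ε₂ / Real.sqrt p := by
        rw [le_div_iff₀ hsqp, mul_comm]
        exact (le_abs_self _).trans (hp₃ p hp3)
      simp only [hMn_def, hQ_def]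
      rw [← sub_le_iff_le_add', sub_neg_eq_add] at h
      refine h.trans ?_
      gcongr
    have herr : ∀ p ∈ Finset.Ico pl N, Z * (p : ℝ) ^ (-α) * ε * Real.exp (-(Q p) / 4) ≤
        Z * (Real.exp (|α| * L₀) * Pα) * ε * Real.exp (-((p : ℝ) - k 2 / k₀) ^ 2 / s) := by
      intro p hp
      obtain ⟨hpl_le, hpN⟩ := Finset.mem_Ico.1 hp
      have hppos : (0 : ℝ) < p := by exact_mod_cast hpl_pos.trans_le hpl_le
      have hpR : (P : ℝ) * k₀ / R' ≤ p := by
        have h1 : (P : ℝ) * k₀ / R' ≤ pl := by rw [hpl_def]; exact Nat.le_ceil _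
        exact h1.trans (by exact_mod_cast hpl_le)
      have hpN' : (p : ℝ) ≤ (N : ℝ) - 1 := by
        have : p + 1 ≤ N := hpN
        have : ((p : ℝ) + 1) ≤ N := by exact_mod_cast this
        linarith only [this]
      -- rpow window
      have hwin : |Real.log ((p : ℝ) / P)| ≤ L₀ := by
        rw [hL₀_def]
        apply abs_log_le_log hM₀1
        · have h1 : 1 / M₀ ≤ 1 / (R' / k₀) :=
            one_div_le_one_div_of_le (by positivity) hM₀R
          have h2 : 1 / (R' / k₀) = k₀ / R' := by rw [one_div_div]
          have h3 : k₀ / R' ≤ (p : ℝ) / P := by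
            rw [div_le_div_iff₀ hR'0 hPpos]
            rw [div_le_iff₀ hR'0] at hpR
            linarith only [hpR]
          linarith only [h1, h2, h3]
        · have h2 : (p : ℝ) / P ≤ 2 * k₀ / a' := by
            rw [div_le_iff₀ hPpos]
            have : 2 * (P : ℝ) * k₀ / a' = 2 * k₀ / a' * P := by ring
            linarith only [hpN', hNle, this]
          exact h2.trans hM₀a
      have hrp := (rpow_neg_window (α := α) hppos hPpos hwin).2
      rw [← hPα_def] at hrp
      -- Gaussian factor
      have hgauss : Real.exp (-(Q p) / 4) ≤ Real.exp (-((p : ℝ) - k 2 / k₀) ^ 2 / s) := by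
        apply Real.exp_le_exp.2
        have h1 : ((p : ℝ) - k 2 / k₀) ^ 2 / s = (k 2 - p * k₀) ^ 2 / (4 * w₃ ^ 2 * N) := by
          rw [hs_def]; field_simp; ring
        have h2 : (k 2 - p * k₀) ^ 2 / (4 * w₃ ^ 2 * N) ≤
            (k 2 - p * k₀) ^ 2 / (4 * w₃ ^ 2 * p) := by
          apply div_le_div_of_nonneg_left (sq_nonneg _) (by positivity)
          have hpN2 : (p : ℝ) ≤ N := by linarith only [hpN']
          exact mul_le_mul_of_nonneg_left hpN2 (by positivity : (0 : ℝ) ≤ 4 * w₃ ^ 2)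
        have h3 : (k 2 - p * k₀) ^ 2 / (4 * w₃ ^ 2 * p) ≤ Q p / 4 := by
          simp only [hQ_def]
          have h4 : 0 ≤ (k 0 ^ 2 + k 1 ^ 2) / (w ^ 2 * p) := by positivity
          have e : (k 2 - p * k₀) ^ 2 / (4 * w₃ ^ 2 * p) =
              (k 2 - p * k₀) ^ 2 / (w₃ ^ 2 * p) / 4 := by ring
          rw [e]
          exact div_le_div_of_nonneg_right (le_add_of_nonneg_left h4) (by norm_num)
        rw [neg_div, neg_div, neg_le_neg_iff, h1]
        exact h2.trans h3
      calc Z * (p : ℝ) ^ (-α) * ε * Real.exp (-(Q p) / 4)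
          ≤ Z * (Real.exp (|α| * L₀) * Pα) * ε * Real.exp (-(Q p) / 4) :=
            mul_le_mul_of_nonneg_right (mul_le_mul_of_nonneg_right
              (mul_le_mul_of_nonneg_left hrp hZ.le) hε.le) (Real.exp_pos _).le
        _ ≤ Z * (Real.exp (|α| * L₀) * Pα) * ε * Real.exp (-((p : ℝ) - k 2 / k₀) ^ 2 / s) :=
            mul_le_mul_of_nonneg_left hgauss (by positivity)
    -- the unweighted part: `1/√p ≤ 1/(c₀ sP)` on `J`, `#J ≤ N ≤ (2k₀/a'+1) P`
    have hsqP : Real.sqrt ((P : ℝ) * k₀ / R') = sP * c₀ := by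
      rw [hsP_def, hc₀_def, ← Real.sqrt_mul hPpos.le]
      congr 1
      ring
    have hηterm : ∀ p ∈ Finset.Ico pl N,
        Z * (p : ℝ) ^ (-α) * (ε₂ / Real.sqrt p) ≤
          Z * (Real.exp (|α| * L₀) * Pα) * (ε₂ / (sP * c₀)) := by
      intro p hp
      obtain ⟨hpl_le, hpN⟩ := Finset.mem_Ico.1 hp
      have hppos : (0 : ℝ) < p := by exact_mod_cast hpl_pos.trans_le hpl_le
      have hpR : (P : ℝ) * k₀ / R' ≤ p := by
        have h1 : (P : ℝ) * k₀ / R' ≤ pl := by rw [hpl_def]; exact Nat.le_ceil _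
        exact h1.trans (by exact_mod_cast hpl_le)
      have hpN' : (p : ℝ) ≤ (N : ℝ) - 1 := by
        have : p + 1 ≤ N := hpN
        have : ((p : ℝ) + 1) ≤ N := by exact_mod_cast this
        linarith only [this]
      have hwin : |Real.log ((p : ℝ) / P)| ≤ L₀ := by
        rw [hL₀_def]
        apply abs_log_le_log hM₀1
        · have h1 : 1 / M₀ ≤ 1 / (R' / k₀) :=
            one_div_le_one_div_of_le (by positivity) hM₀R
          have h2 : 1 / (R' / k₀) = k₀ / R' := by rw [one_div_div]
          have h3 : k₀ / R' ≤ (p : ℝ) / P := by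
            rw [div_le_div_iff₀ hR'0 hPpos]
            rw [div_le_iff₀ hR'0] at hpR
            linarith only [hpR]
          linarith only [h1, h2, h3]
        · have h2 : (p : ℝ) / P ≤ 2 * k₀ / a' := by
            rw [div_le_iff₀ hPpos]
            have : 2 * (P : ℝ) * k₀ / a' = 2 * k₀ / a' * P := by ring
            linarith only [hpN', hNle, this]
          exact h2.trans hM₀a
      have hrp := (rpow_neg_window (α := α) hppos hPpos hwin).2
      rw [← hPα_def] at hrp
      have hsq : sP * c₀ ≤ Real.sqrt p := by
        rw [← hsqP]
        exact Real.sqrt_le_sqrt hpR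
      have hsc : 0 < sP * c₀ := mul_pos hsPpos hc₀
      have h1 : ε₂ / Real.sqrt p ≤ ε₂ / (sP * c₀) := div_le_div_of_nonneg_left hε₂.le hsc hsq
      exact mul_le_mul (mul_le_mul_of_nonneg_left hrp hZ.le) h1 (by positivity) (by positivity)
    have hcardJ : ((Finset.Ico pl N).card : ℝ) ≤ (2 * k₀ / a' + 1) * P := by
      rw [Nat.card_Ico]
      have h1 : ((N - pl : ℕ) : ℝ) ≤ N := by exact_mod_cast Nat.sub_le N pl
      have h2 : (N : ℝ) ≤ 2 * P * k₀ / a' + 1 := by linarith only [hNle]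
      have h3 : 2 * (P : ℝ) * k₀ / a' + 1 ≤ (2 * k₀ / a' + 1) * P := by
        rw [add_mul]
        have : 2 * (P : ℝ) * k₀ / a' = 2 * k₀ / a' * P := by ring
        rw [this]; linarith only [hP1]
      exact h1.trans (h2.trans h3)
    have herrsum : ∑ p ∈ Finset.Ico pl N, (mode v₀ p t k 0 + Mn p) ≤
        Z * ε * C₂ * sP * Pα + Z * ε₂ * C₃ * sP * Pα := by
      have hsplit : ∀ p ∈ Finset.Ico pl N, mode v₀ p t k 0 + Mn p ≤
          Z * (Real.exp (|α| * L₀) * Pα) * ε * Real.exp (-((p : ℝ) - k 2 / k₀) ^ 2 / s) +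
            Z * (Real.exp (|α| * L₀) * Pα) * (ε₂ / (sP * c₀)) := by
        intro p hp
        refine (hdecomp p hp).trans ?_
        rw [mul_add]
        have h := herr p hp
        rw [mul_assoc (Z * (p : ℝ) ^ (-α)) ε] at h
        exact add_le_add h (hηterm p hp)
      calc ∑ p ∈ Finset.Ico pl N, (mode v₀ p t k 0 + Mn p)
          ≤ ∑ p ∈ Finset.Ico pl N, (Z * (Real.exp (|α| * L₀) * Pα) * ε *
              Real.exp (-((p : ℝ) - k 2 / k₀) ^ 2 / s) +
              Z * (Real.exp (|α| * L₀) * Pα) * (ε₂ / (sP * c₀))) := Finset.sum_le_sum hsplit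
        _ = Z * (Real.exp (|α| * L₀) * Pα) * ε *
              ∑ p ∈ Finset.Ico pl N, Real.exp (-((p : ℝ) - k 2 / k₀) ^ 2 / s) +
              (Finset.Ico pl N).card * (Z * (Real.exp (|α| * L₀) * Pα) * (ε₂ / (sP * c₀))) := by
            rw [Finset.sum_add_distrib, Finset.mul_sum, Finset.sum_const, nsmul_eq_mul]
        _ ≤ Z * (Real.exp (|α| * L₀) * Pα) * ε * (4 * Real.exp (5 / 4) * Real.sqrt s) +
              (2 * k₀ / a' + 1) * P * (Z * (Real.exp (|α| * L₀) * Pα) * (ε₂ / (sP * c₀))) :=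
            add_le_add
              (mul_le_mul_of_nonneg_left (sum_exp_neg_sq_integerWindow_le hs1 _ _) (by positivity))
              (mul_le_mul_of_nonneg_right hcardJ (by positivity))
        _ ≤ Z * (Real.exp (|α| * L₀) * Pα) * ε *
              (4 * Real.exp (5 / 4) * ((2 * w₃ / k₀) * (Real.sqrt (2 * k₀ / a' + 1) * sP))) +
              (2 * k₀ / a' + 1) * P * (Z * (Real.exp (|α| * L₀) * Pα) * (ε₂ / (sP * c₀))) := by
            refine add_le_add ?_ le_rfl
            exact mul_le_mul_of_nonneg_left (mul_le_mul_of_nonneg_left hsqs (by positivity))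
              (by positivity)
        _ = Z * ε * C₂ * sP * Pα + Z * ε₂ * C₃ * sP * Pα := by
            have hc₀' : c₀ ≠ 0 := hc₀.ne'
            have hsP' : sP ≠ 0 := hsPpos.ne'
            rw [hC₂_def, hC₃_def, ← hsPsP]
            field_simp
    -- the coherent window `W`
    obtain ⟨n₁, hn₁_def⟩ : ∃ n₁ : ℕ, n₁ = ⌈(k 2 - w₃ * sP) / k₀⌉₊ := ⟨_, rfl⟩
    obtain ⟨mW, hmW_def⟩ : ∃ mW : ℕ, mW = ⌊2 * w₃ * sP / k₀⌋₊ := ⟨_, rfl⟩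
    obtain ⟨W, hW_def⟩ : ∃ W : Finset ℕ, W = (Finset.range mW).image (fun i => n₁ + i) := ⟨_, rfl⟩
    have hk2w : 0 ≤ (k 2 - w₃ * sP) / k₀ := by
      apply div_nonneg _ hk₀.le
      linarith only [hk2l, hw₃sP, hPk]
    have hn₁l : (k 2 - w₃ * sP) / k₀ ≤ n₁ := by rw [hn₁_def]; exact Nat.le_ceil _
    have hn₁u : (n₁ : ℝ) < (k 2 - w₃ * sP) / k₀ + 1 := by
      rw [hn₁_def]; exact Nat.ceil_lt_add_one hk2w
    have hmWu : (mW : ℝ) ≤ 2 * w₃ * sP / k₀ := by rw [hmW_def]; exact Nat.floor_le (by positivity)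
    have hmWl : w₃ * sP / k₀ ≤ mW := by
      have h1 := Nat.lt_floor_add_one (2 * w₃ * sP / k₀)
      rw [← hmW_def] at h1
      have e : 2 * w₃ * sP / k₀ = 2 * (w₃ * sP / k₀) := by ring
      linarith only [h1, e, hsPk]
    have hWcard : W.card = mW := by
      rw [hW_def, Finset.card_image_of_injective _ (add_right_injective n₁), Finset.card_range]
    have hWprop : ∀ p ∈ W, (P : ℝ) / 2 ≤ p ∧ (p : ℝ) ≤ 3 * P ∧ |k 2 - p * k₀| ≤ w₃ * sP := by
      intro p hp
      rw [hW_def, Finset.mem_image] at hp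
      obtain ⟨i, hi, rfl⟩ := hp
      have hi' : (i : ℝ) + 1 ≤ mW := by exact_mod_cast Finset.mem_range.1 hi
      push_cast
      have hlow' : k 2 - w₃ * sP ≤ (n₁ : ℝ) * k₀ := by rwa [div_le_iff₀ hk₀] at hn₁l
      have hup' : ((n₁ : ℝ) + i) * k₀ ≤ k 2 + w₃ * sP := by
        have h1 : (n₁ : ℝ) + i ≤ (k 2 - w₃ * sP) / k₀ + 2 * w₃ * sP / k₀ := by
          linarith only [hn₁u, hi', hmWu]
        have h2 : (k 2 - w₃ * sP) / k₀ + 2 * w₃ * sP / k₀ = (k 2 + w₃ * sP) / k₀ := by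
          field_simp; ring
        rw [h2, le_div_iff₀ hk₀] at h1
        exact h1
      have hi0 : (0 : ℝ) ≤ i := Nat.cast_nonneg i
      have hik : 0 ≤ (i : ℝ) * k₀ := mul_nonneg hi0 hk₀.le
      refine ⟨?_, ?_, ?_⟩
      · have : (P : ℝ) / 2 * k₀ ≤ ((n₁ : ℝ) + i) * k₀ := by
          linarith only [hlow', hk2l, hw₃sP, hik]
        exact le_of_mul_le_mul_right this hk₀
      · have : ((n₁ : ℝ) + i) * k₀ ≤ 3 * P * k₀ := by
          linarith only [hup', hk2u, hw₃sP, hPk]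
        exact le_of_mul_le_mul_right this hk₀
      · rw [abs_le]; constructor <;> linarith only [hlow', hup', hik]
    have hWsub : W ⊆ Finset.Ico pl N := by
      intro p hp
      obtain ⟨hpl', hpu', -⟩ := hWprop p hp
      rw [Finset.mem_Ico]
      constructor
      · rw [hpl_def]
        refine Nat.ceil_le.2 ?_
        have : (P : ℝ) * k₀ / R' ≤ P / 2 := by
          rw [div_le_iff₀ hR'0]
          have := mul_le_mul_of_nonneg_left hR'k hPpos.le
          linarith only [this]
        linarith only [this, hpl']
      · have : (p : ℝ) < N := by linarith only [hpu', hNge, hPpos]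
        exact_mod_cast this
    -- per-term lower bound on `W`
    obtain ⟨b, hb_def⟩ : ∃ b : ℝ,
        b = Z * (Real.exp (-(|α| * Real.log 3)) * Pα) * Real.exp (-6) * (1 / 2) := ⟨_, rfl⟩
    have hb0 : 0 ≤ b := by rw [hb_def]; positivity
    have hbW : ∀ p ∈ W, b ≤ Mn p := by
      intro p hp
      obtain ⟨hpl', hpu', hpk⟩ := hWprop p hp
      have hppos : (0 : ℝ) < p := by linarith only [hpl', hPpos]
      have hwin : |Real.log ((p : ℝ) / P)| ≤ Real.log 3 := by
        apply abs_log_le_log (by norm_num)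
        · rw [le_div_iff₀ hPpos]; linarith only [hpl', hPpos]
        · rw [div_le_iff₀ hPpos]; linarith only [hpu']
      have hrp := (rpow_neg_window (α := α) hppos hPpos hwin).1
      rw [← hPα_def] at hrp
      have hQ : Q p ≤ 12 := by
        simp only [hQ_def]
        have h1 : (k 0 ^ 2 + k 1 ^ 2) / (w ^ 2 * p) ≤ 10 := by
          rw [div_le_iff₀ (by positivity)]
          have e1 : k 0 ^ 2 ≤ 4 * w ^ 2 * P := by
            have h := mul_le_mul hk0u hk0u hk0pos.le (by positivity)
            have e : 2 * w * sP * (2 * w * sP) = 4 * w ^ 2 * (sP * sP) := by ring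
            rw [e, hsPsP] at h
            rw [sq]; exact h
          have e2 : k 1 ^ 2 ≤ w ^ 2 * P := by
            have h := mul_le_mul hk1u hk1u hk1l (by positivity)
            have e : w * sP * (w * sP) = w ^ 2 * (sP * sP) := by ring
            rw [e, hsPsP] at h
            rw [sq]; exact h
          have e3 : w ^ 2 * P ≤ w ^ 2 * (2 * p) :=
            mul_le_mul_of_nonneg_left (by linarith only [hpl']) (sq_nonneg w)
          linarith only [e1, e2, e3]
        have h2 : (k 2 - p * k₀) ^ 2 / (w₃ ^ 2 * p) ≤ 2 := by
          rw [div_le_iff₀ (by positivity)]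
          have e1 : (k 2 - p * k₀) ^ 2 ≤ (w₃ * sP) ^ 2 := by
            rw [abs_le] at hpk
            exact sq_le_sq' hpk.1 hpk.2
          have e2 : (w₃ * sP) ^ 2 = w₃ ^ 2 * P := by rw [← hsPsP]; ring
          have e3 : w₃ ^ 2 * P ≤ w₃ ^ 2 * (2 * p) :=
            mul_le_mul_of_nonneg_left (by linarith only [hpl']) (sq_nonneg w₃)
          linarith only [e1, e2, e3]
        linarith only [h1, h2]
      have hexp : Real.exp (-6) ≤ Real.exp (-(Q p) / 2) :=
        Real.exp_le_exp.2 (by rw [neg_div]; linarith only [hQ])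
      have hrat : 1 / 2 ≤ k 0 / (w * Real.sqrt p) := by
        have hsq : Real.sqrt p ≤ 2 * sP := by
          rw [Real.sqrt_le_iff]
          refine ⟨by positivity, ?_⟩
          have e : (2 * sP) ^ 2 = 4 * (sP * sP) := by ring
          rw [e, hsPsP]
          linarith only [hpu']
        have hsqpos : 0 < Real.sqrt p := Real.sqrt_pos.2 hppos
        rw [le_div_iff₀ (by positivity)]
        have := mul_le_mul_of_nonneg_left hsq hw.le
        linarith only [this, hk0l]
      calc b = Z * (Real.exp (-(|α| * Real.log 3)) * Pα) * Real.exp (-6) * (1 / 2) := hb_def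
        _ ≤ Z * (p : ℝ) ^ (-α) * Real.exp (-(Q p) / 2) * (k 0 / (w * Real.sqrt p)) :=
            mul_le_mul (mul_le_mul (mul_le_mul_of_nonneg_left hrp hZ.le) hexp
              (Real.exp_pos _).le (by positivity)) hrat (by norm_num) (by positivity)
        _ = Mn p := by simp only [hMn_def]
    have hMn_nonneg : ∀ p ∈ Finset.Ico pl N, 0 ≤ Mn p := by
      intro p _
      simp only [hMn_def]
      have : 0 ≤ k 0 := hk0pos.le
      positivity
    -- assembling the two estimates
    have hmain : (mW : ℝ) * b ≤ ∑ p ∈ Finset.Ico pl N, Mn p := by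
      calc (mW : ℝ) * b = ∑ p ∈ W, b := by rw [Finset.sum_const, hWcard, nsmul_eq_mul]
        _ ≤ ∑ p ∈ W, Mn p := Finset.sum_le_sum hbW
        _ ≤ ∑ p ∈ Finset.Ico pl N, Mn p :=
            Finset.sum_le_sum_of_subset_of_nonneg hWsub fun p hp _ => hMn_nonneg p hp
    have hv0 : (mW : ℝ) * b - (Z * ε * C₂ * sP * Pα + Z * ε₂ * C₃ * sP * Pα) ≤
        -(seriesSolution v₀ t k 0) := by
      rw [hcoord]
      have e : ∑ p ∈ Finset.Ico pl N, mode v₀ p t k 0 =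
          ∑ p ∈ Finset.Ico pl N, (mode v₀ p t k 0 + Mn p) - ∑ p ∈ Finset.Ico pl N, Mn p := by
        rw [← Finset.sum_sub_distrib]
        simp
      rw [e]
      linarith only [herrsum, hmain]
    have hmWb : Z * C₁ * sP * Pα ≤ (mW : ℝ) * b := by
      have e : Z * C₁ * sP * Pα = (w₃ * sP / k₀) * b := by
        rw [hC₁_def, hb_def]; field_simp
      rw [e]
      exact mul_le_mul_of_nonneg_right hmWl hb0
    have hεC : Z * ε * C₂ * sP * Pα + Z * ε₂ * C₃ * sP * Pα = Z * C₁ * sP * Pα / 2 := by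
      have hC₂' : C₂ ≠ 0 := hC₂.ne'
      have hC₃' : C₃ ≠ 0 := hC₃.ne'
      rw [hε_def, hε₂_def]; field_simp; ring
    have hfin : m ≤ -(seriesSolution v₀ t k 0) := by
      rw [hm_def]; linarith only [hv0, hmWb, hεC]
    calc m ≤ -(seriesSolution v₀ t k 0) := hfin
      _ ≤ |seriesSolution v₀ t k 0| := neg_le_abs _
      _ = ‖seriesSolution v₀ t k 0‖ := (Real.norm_eq_abs _).symm
      _ ≤ ‖seriesSolution v₀ t k‖ := PiLp.norm_apply_le _ 0
  /- integrating over the box -/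
  have hint : ENNReal.ofReal (m ^ 2) * volume B ≤ ∫⁻ k, ‖seriesSolution v₀ t k‖ₑ ^ 2 := by
    rw [← lintegral_indicator_const hBmeas]
    refine lintegral_mono fun k => ?_
    by_cases hk : k ∈ B
    · rw [indicator_of_mem hk]
      have h1 : ENNReal.ofReal m ≤ ‖seriesSolution v₀ t k‖ₑ := by
        rw [← ofReal_norm]
        exact ENNReal.ofReal_le_ofReal (hlow k hk)
      calc ENNReal.ofReal (m ^ 2) = ENNReal.ofReal m ^ 2 := by
            rw [ENNReal.ofReal_pow hm0.le]
        _ ≤ ‖seriesSolution v₀ t k‖ₑ ^ 2 := by gcongr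
    · rw [indicator_of_notMem hk]
      exact bot_le
  refine le_trans ?_ hint
  rw [hBvol, ← ENNReal.ofReal_mul (sq_nonneg _), ← ENNReal.ofReal_coe_nnreal]
  refine ENNReal.ofReal_le_ofReal (hP6.trans (le_of_eq ?_))
  have h3 : (P : ℝ) ^ (3 - 2 * α) = (P : ℝ) ^ 3 * Pα ^ 2 := by
    rw [hPα_def, ← Real.rpow_mul_natCast hPpos.le, ← Real.rpow_natCast (P : ℝ) 3,
      ← Real.rpow_add hPpos]
    congr 1
    push_cast
    ring
  rw [h3, hm_def, hK_def, ← hsPsP]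
  ring


/-- **Quasi-coherent Gaussian–Hermite terms at one time force infinite energy at that time** —
the general form of `energy_eq_top_of_coherentGaussianModes` below (§10 p. 312 made rigorous for
the terms of the series (46)), in which the error is allowed an additional UNWEIGHTED part
`Z p^{-α} η_p` with `√p · η_p → 0` besides the Gaussian-weighted `Z p^{-α} δ_p e^{-Q/4}`,
`δ_p → 0` (this is the form a heat-kernel localisation in time can deliver, the plain sup norm
of the `≍ P` terms overlapping at a wave vector of height `≍ P k₀` being summable against
`η_p = o(p^{-1/2})` only). Let the datum `v₀` vanish off `{a ≤ k₃, |k| ≤ R}` with `a > 0`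
(the printed data (39), §7 p. 295, do), let `k₀, w, w₃, Z > 0`, `α < 3/2`, `δ_p → 0`, and suppose
that for all `p ≥ p₁` and all `k` the first component of the `p`-th term of the series at time
`t` is the Gaussian–Hermite profile of Theorem 1 (a₁) (p. 311; `H₁⁽⁰⁾(Y) = -2Y₁`, §7 p. 295) up
to a Gaussian-weighted `o(1)`:
`|mode v₀ p t k 0 + Z p^{-α} e^{-Q/2} k₁/(w√p)| ≤ Z p^{-α} (δ_p e^{-Q/4} + η_p)`,
`Q = (k₁² + k₂²)/(w² p) + (k₃ - p k₀)²/(w₃² p)`.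
Then `∫ ‖seriesSolution v₀ t k‖² dk = ∞`. [cite: LiSinai2008, Thm. 1 p. 311 and §10 p. 312] -/
theorem energy_eq_top_of_quasiCoherentGaussianModes
    {v₀ : EuclideanSpace ℝ (Fin 3) → EuclideanSpace ℝ (Fin 3)} {a R : ℝ} (ha : 0 < a)
    (hv₀ : ∀ k, v₀ k ≠ 0 → a ≤ k 2 ∧ ‖k‖ ≤ R)
    {t k₀ w w₃ Z α : ℝ} (hk₀ : 0 < k₀) (hw : 0 < w) (hw₃ : 0 < w₃) (hZ : 0 < Z) (hα : α < 3 / 2)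
    {p₁ : ℕ} {δ η : ℕ → ℝ} (hδ : Tendsto δ atTop (𝓝 0))
    (hη : Tendsto (fun p : ℕ => Real.sqrt p * η p) atTop (𝓝 0))
    (hmode : ∀ p : ℕ, p₁ ≤ p → ∀ k : EuclideanSpace ℝ (Fin 3),
      |mode v₀ p t k 0 + Z * (p : ℝ) ^ (-α) *
          Real.exp (-((k 0 ^ 2 + k 1 ^ 2) / (w ^ 2 * p) + (k 2 - p * k₀) ^ 2 / (w₃ ^ 2 * p)) / 2) *
          (k 0 / (w * Real.sqrt p))| ≤
        Z * (p : ℝ) ^ (-α) * (δ p *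
          Real.exp (-((k 0 ^ 2 + k 1 ^ 2) / (w ^ 2 * p) + (k 2 - p * k₀) ^ 2 / (w₃ ^ 2 * p)) / 4) +
          η p)) :
    ∫⁻ k, ‖seriesSolution v₀ t k‖ₑ ^ 2 = ∞ :=
  energy_eq_top_of_coherentOneSidedModes ha hv₀ hk₀ hw hw₃ hZ hα hδ hη fun p hp k _ => by
    have h := (abs_le.1 (hmode p hp k)).2
    linarith only [h]

/-- **Coherent Gaussian–Hermite terms at one time force infinite energy at that time** — the
inference "there it takes values `O(p)`. This immediately implies that at `t` the energy is
infinite" of §10 p. 312 made rigorous for the terms of the series (46), at the generality of an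
arbitrary polynomial prefactor. Let the datum `v₀` vanish off `{a ≤ k₃, |k| ≤ R}` with `a > 0`
(the printed data (39), §7 p. 295, do), let `k₀, w, w₃, Z > 0`, `α < 3/2`, `δ_p → 0`, and suppose
that for all `p ≥ p₁` and all `k` the first component of the `p`-th term of the series at time
`t` is the Gaussian–Hermite profile of Theorem 1 (a₁) (p. 311; `H₁⁽⁰⁾(Y) = -2Y₁`, §7 p. 295) up
to a Gaussian-weighted `o(1)`:
`|mode v₀ p t k 0 + Z p^{-α} e^{-Q/2} k₁/(w√p)| ≤ Z p^{-α} δ_p e^{-Q/4}`,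
`Q = (k₁² + k₂²)/(w² p) + (k₃ - p k₀)²/(w₃² p)`.
Then `∫ ‖seriesSolution v₀ t k‖² dk = ∞`. The mechanism is the coherence of the sign of the
main terms of the `≍ √P` overlapping generations at height `k₃ ≍ P k₀` (see the module
docstring for the estimate, and for what this does NOT prove). No measurability, boundedness
or sign condition on `t` is needed. [cite: LiSinai2008, Thm. 1 p. 311 and §10 p. 312] -/
theorem energy_eq_top_of_coherentGaussianModes
    {v₀ : EuclideanSpace ℝ (Fin 3) → EuclideanSpace ℝ (Fin 3)} {a R : ℝ} (ha : 0 < a) (hv₀ : ∀ k, v₀ k ≠ 0 → a ≤ k 2 ∧ ‖k‖ ≤ R)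
    {t k₀ w w₃ Z α : ℝ} (hk₀ : 0 < k₀) (hw : 0 < w) (hw₃ : 0 < w₃) (hZ : 0 < Z) (hα : α < 3 / 2)
    {p₁ : ℕ} {δ : ℕ → ℝ} (hδ : Tendsto δ atTop (𝓝 0))
    (hmode : ∀ p : ℕ, p₁ ≤ p → ∀ k : EuclideanSpace ℝ (Fin 3),
      |mode v₀ p t k 0 + Z * (p : ℝ) ^ (-α) *
          Real.exp (-((k 0 ^ 2 + k 1 ^ 2) / (w ^ 2 * p) + (k 2 - p * k₀) ^ 2 / (w₃ ^ 2 * p)) / 2) *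
          (k 0 / (w * Real.sqrt p))| ≤
        Z * (p : ℝ) ^ (-α) * δ p *
          Real.exp (-((k 0 ^ 2 + k 1 ^ 2) / (w ^ 2 * p) + (k 2 - p * k₀) ^ 2 / (w₃ ^ 2 * p)) / 4)) :
    ∫⁻ k, ‖seriesSolution v₀ t k‖ₑ ^ 2 = ∞ := by
  refine energy_eq_top_of_quasiCoherentGaussianModes (p₁ := p₁) (η := fun _ => 0) ha hv₀ hk₀ hw
    hw₃ hZ hα hδ (by simp) fun p hp k => ?_
  rw [add_zero, ← mul_assoc]
  exact hmode p hp k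

/-- **Vector form, as in Theorem 1 (a₁).** The same conclusion when the whole `p`-th term is the
Gaussian–Hermite vector profile `-Z p^{-α} e^{-Q/2} (k₁, k₂, 0)/(w√p)` (the fixed point
`H⁽⁰⁾(Y) = -2(Y₁, Y₂)` with vanishing main third component, §7 p. 295 and Thm. 1 p. 311, constants
absorbed into `Z, w`) up to a Gaussian-weighted `o(1)` in norm: the first-component hypothesis
of `energy_eq_top_of_coherentGaussianModes` follows from `|x₁| ≤ ‖x‖`. Here
`k - k₃ e₃ = (k₁, k₂, 0)`, `e₃ = EuclideanSpace.single 2 1`.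
[cite: LiSinai2008, Thm. 1 p. 311 and §10 p. 312] -/
theorem energy_eq_top_of_gaussianHermiteModes
    {v₀ : EuclideanSpace ℝ (Fin 3) → EuclideanSpace ℝ (Fin 3)} {a R : ℝ} (ha : 0 < a) (hv₀ : ∀ k, v₀ k ≠ 0 → a ≤ k 2 ∧ ‖k‖ ≤ R)
    {t k₀ w w₃ Z α : ℝ} (hk₀ : 0 < k₀) (hw : 0 < w) (hw₃ : 0 < w₃) (hZ : 0 < Z) (hα : α < 3 / 2)
    {p₁ : ℕ} {δ : ℕ → ℝ} (hδ : Tendsto δ atTop (𝓝 0))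
    (hmode : ∀ p : ℕ, p₁ ≤ p → ∀ k : EuclideanSpace ℝ (Fin 3),
      ‖mode v₀ p t k + (Z * (p : ℝ) ^ (-α) *
          Real.exp (-((k 0 ^ 2 + k 1 ^ 2) / (w ^ 2 * p) + (k 2 - p * k₀) ^ 2 / (w₃ ^ 2 * p)) / 2) /
          (w * Real.sqrt p)) • (k - k 2 • EuclideanSpace.single (2 : Fin 3) (1 : ℝ))‖ ≤
        Z * (p : ℝ) ^ (-α) * δ p *
          Real.exp (-((k 0 ^ 2 + k 1 ^ 2) / (w ^ 2 * p) + (k 2 - p * k₀) ^ 2 / (w₃ ^ 2 * p)) / 4)) :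
    ∫⁻ k, ‖seriesSolution v₀ t k‖ₑ ^ 2 = ∞ := by
  refine energy_eq_top_of_coherentGaussianModes (p₁ := p₁) ha hv₀ hk₀ hw hw₃ hZ hα hδ
    fun p hp k => ?_
  refine le_trans ?_ (hmode p hp k)
  refine le_trans (le_of_eq ?_) (PiLp.norm_apply_le _ 0)
  rw [Real.norm_eq_abs]
  congr 1
  simp
  ring

end LiSinai

open LiSinai

/-! ### Consequences for the catalogue facts -/

/-- **Coherent Gaussian terms at one positive time give `LiSinaiSeriesEnergyInfinite`** (hence
the Theorem-1-backed literal form `LiSinaiCriticalEnergyBlowupNarrow`, by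
`LiSinaiSeriesEnergyInfinite.criticalEnergyBlowupNarrow`): for an admissible datum (measurable,
bounded, vanishing off `{a ≤ k₃, |k| ≤ R}` with `a > 0`, incompressible) whose series has, at
some `t > 0`, terms with the coherent Gaussian–Hermite first components of
`LiSinai.energy_eq_top_of_coherentGaussianModes`. [cite: LiSinai2008, Thm. 1 p. 311 and
§10 p. 312] -/
theorem LiSinaiSeriesEnergyInfinite.of_coherentGaussianModes
    {v₀ : EuclideanSpace ℝ (Fin 3) → EuclideanSpace ℝ (Fin 3)} {a R : ℝ} (ha : 0 < a) (hv₀m : Measurable v₀) (hbdd : ∃ M : ℝ, ∀ k, ‖v₀ k‖ ≤ M)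
    (hv₀ : ∀ k, v₀ k ≠ 0 → a ≤ k 2 ∧ ‖k‖ ≤ R) (hdiv : ∀ k, ⟪v₀ k, k⟫ = 0)
    {t k₀ w w₃ Z α : ℝ} (ht : 0 < t) (hk₀ : 0 < k₀) (hw : 0 < w) (hw₃ : 0 < w₃) (hZ : 0 < Z)
    (hα : α < 3 / 2) {p₁ : ℕ} {δ : ℕ → ℝ} (hδ : Tendsto δ atTop (𝓝 0))
    (hmode : ∀ p : ℕ, p₁ ≤ p → ∀ k : EuclideanSpace ℝ (Fin 3),
      |mode v₀ p t k 0 + Z * (p : ℝ) ^ (-α) *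
          Real.exp (-((k 0 ^ 2 + k 1 ^ 2) / (w ^ 2 * p) + (k 2 - p * k₀) ^ 2 / (w₃ ^ 2 * p)) / 2) *
          (k 0 / (w * Real.sqrt p))| ≤
        Z * (p : ℝ) ^ (-α) * δ p *
          Real.exp (-((k 0 ^ 2 + k 1 ^ 2) / (w ^ 2 * p) + (k 2 - p * k₀) ^ 2 / (w₃ ^ 2 * p)) / 4)) :
    LiSinaiSeriesEnergyInfinite :=
  ⟨v₀, a, R, t, ha, ht, hv₀m, hbdd, hv₀, hdiv,
    energy_eq_top_of_coherentGaussianModes ha hv₀ hk₀ hw hw₃ hZ hα hδ hmode⟩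

/-- **§10 of the source as a sufficient condition for the energy-profile fact.** If an admissible
datum has, at some `t > 0`, series terms with the coherent Gaussian–Hermite first components of
`LiSinai.energy_eq_top_of_coherentGaussianModes` (the reading of Theorem 1 (a₁) at the critical
amplitude, "there it takes values `O(p)`", §10 p. 312) AND, at every earlier time `τ ∈ [0, t)`,
geometrically decaying terms `‖mode v₀ p (τ, ·)‖_∞ ≤ C_τ q_τ^p`, `0 ≤ q_τ < 1` (what §10 asserts
for `t' < t`: "for `p ≫ O(1/Δt)` the product `A_cr Λ(t')^p` tends exponentially to zero"), then
`LiSinaiSeriesEnergyBlowup` holds: infinite energy at `t` by the coherence theorem, finite energy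
before by `LiSinaiSeriesEnergyBlowup.of_infinite_of_modeDecay`. This isolates what a proof of
Theorem 1 must deliver for the barrier; neither hypothesis is proved here.
[cite: LiSinai2008, Thm. 1 p. 311 and §10 p. 312] -/
theorem LiSinaiSeriesEnergyBlowup.of_coherentGaussianModes_of_modeDecay
    {v₀ : EuclideanSpace ℝ (Fin 3) → EuclideanSpace ℝ (Fin 3)} {a R : ℝ} (ha : 0 < a) (hv₀m : Measurable v₀) (hbdd : ∃ M : ℝ, ∀ k, ‖v₀ k‖ ≤ M)
    (hv₀ : ∀ k, v₀ k ≠ 0 → a ≤ k 2 ∧ ‖k‖ ≤ R) (hdiv : ∀ k, ⟪v₀ k, k⟫ = 0)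
    {t k₀ w w₃ Z α : ℝ} (ht : 0 < t) (hk₀ : 0 < k₀) (hw : 0 < w) (hw₃ : 0 < w₃) (hZ : 0 < Z)
    (hα : α < 3 / 2) {p₁ : ℕ} {δ : ℕ → ℝ} (hδ : Tendsto δ atTop (𝓝 0))
    (hmode : ∀ p : ℕ, p₁ ≤ p → ∀ k : EuclideanSpace ℝ (Fin 3),
      |mode v₀ p t k 0 + Z * (p : ℝ) ^ (-α) *
          Real.exp (-((k 0 ^ 2 + k 1 ^ 2) / (w ^ 2 * p) + (k 2 - p * k₀) ^ 2 / (w₃ ^ 2 * p)) / 2) *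
          (k 0 / (w * Real.sqrt p))| ≤
        Z * (p : ℝ) ^ (-α) * δ p *
          Real.exp (-((k 0 ^ 2 + k 1 ^ 2) / (w ^ 2 * p) + (k 2 - p * k₀) ^ 2 / (w₃ ^ 2 * p)) / 4))
    (hdecay : ∀ τ ∈ Ico 0 t, ∃ C q : ℝ, 0 ≤ q ∧ q < 1 ∧ ∀ p k, ‖mode v₀ p τ k‖ ≤ C * q ^ p) :
    LiSinaiSeriesEnergyBlowup :=
  LiSinaiSeriesEnergyBlowup.of_infinite_of_modeDecay
    ⟨v₀, a, R, t, ha, ht, hv₀m, hbdd, hv₀, hdiv, hdecay,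
      energy_eq_top_of_coherentGaussianModes ha hv₀ hk₀ hw hw₃ hZ hα hδ hmode⟩

/-- **The catalogue barrier from the two analytic inputs of §10** (coherent Gaussian–Hermite terms
at `t`, geometric decay of the terms before `t`), via
`LiSinaiSeriesEnergyBlowup.of_coherentGaussianModes_of_modeDecay` and
`LiSinaiSeriesEnergyBlowup.complexNavierStokesBlowup`. With both inputs proved for one admissible
datum this would be `ComplexNavierStokesBlowup_holds`; they are Theorem 1 of the source and are
not proved here. [cite: LiSinai2008, Thm. 1 p. 311 and §10 p. 312] -/
theorem complexNavierStokesBlowup_of_coherentGaussianModes_of_modeDecay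
    {v₀ : EuclideanSpace ℝ (Fin 3) → EuclideanSpace ℝ (Fin 3)} {a R : ℝ} (ha : 0 < a) (hv₀m : Measurable v₀) (hbdd : ∃ M : ℝ, ∀ k, ‖v₀ k‖ ≤ M)
    (hv₀ : ∀ k, v₀ k ≠ 0 → a ≤ k 2 ∧ ‖k‖ ≤ R) (hdiv : ∀ k, ⟪v₀ k, k⟫ = 0)
    {t k₀ w w₃ Z α : ℝ} (ht : 0 < t) (hk₀ : 0 < k₀) (hw : 0 < w) (hw₃ : 0 < w₃) (hZ : 0 < Z)
    (hα : α < 3 / 2) {p₁ : ℕ} {δ : ℕ → ℝ} (hδ : Tendsto δ atTop (𝓝 0))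
    (hmode : ∀ p : ℕ, p₁ ≤ p → ∀ k : EuclideanSpace ℝ (Fin 3),
      |mode v₀ p t k 0 + Z * (p : ℝ) ^ (-α) *
          Real.exp (-((k 0 ^ 2 + k 1 ^ 2) / (w ^ 2 * p) + (k 2 - p * k₀) ^ 2 / (w₃ ^ 2 * p)) / 2) *
          (k 0 / (w * Real.sqrt p))| ≤
        Z * (p : ℝ) ^ (-α) * δ p *
          Real.exp (-((k 0 ^ 2 + k 1 ^ 2) / (w ^ 2 * p) + (k 2 - p * k₀) ^ 2 / (w₃ ^ 2 * p)) / 4))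
    (hdecay : ∀ τ ∈ Ico 0 t, ∃ C q : ℝ, 0 ≤ q ∧ q < 1 ∧ ∀ p k, ‖mode v₀ p τ k‖ ≤ C * q ^ p) :
    ComplexNavierStokesBlowup :=
  (LiSinaiSeriesEnergyBlowup.of_coherentGaussianModes_of_modeDecay ha hv₀m hbdd hv₀ hdiv ht hk₀ hw
    hw₃ hZ hα hδ hmode hdecay).complexNavierStokesBlowup

end Literature.Barriers.NavierStokesRegularity
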